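import Summits.Ventures.CertifiedManyBodySolver.Downfold.EmeryShapeTwoRayRule
import Summits.Ventures.CertifiedManyBodySolver.Downfold.EmeryFermiSurfaceShapeBox
import HarnessLib

/-!
# THE WINDOW CLOSURE OF THE TWO-RAY RULE: the fixed-doping `t′/t` of every member of a typed three-band box lies between
# `inf_{ε ∈ W_lo} fsRatio(V_lo; ε)` and `sup_{ε ∈ W_hi} fsRatio(V_hi; ε)` for two certified ENERGY WINDOWS at the two virtual corners — unconditional
# (no discriminant hypothesis); with the exact energy-difference formula of the shape and its Lipschitz-in-energy window bounds

Venture CertifiedManyBodySolver, cell `pub/hubbard-downfold` (stage S1; INFLATION-RULES-3to1-B §B.86 (d)–(g)), seat hubbard-downfold-mod-4 (technique B = band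
level, g35); namespace `Summit.Ventures.CertifiedManyBodySolver.Downfold.Emery`. Everything PROVED (0 sorry, no definition). WHAT THIS IS NOT: a statement
about any material; `U = 0` one-body kinematics of the σ (d–p_x–p_y + t_pp, t_pp′) model; no number lives here.

`EmeryShapeTwoRayRule` squeezes every member `θ` of `[Δ₁, Δ₂] × [a₁, a₂] × [b₁, b₂] × [c₁, c₂]` between the two rows on its own oxygen ray,
`R(Δ₁, a₁, b₂, c·b₂/b) ≤ R(θ) ≤ R(Δ₂, a₂, b₁, c·b₁/b)`, and collapses the rays onto the virtual corners `V_lo = (Δ₁, a₁, b₂, c₂b₂/b₁)`,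
`V_hi = (Δ₂, a₂, b₁, c₁b₁/b₂)` with the CONDITIONAL `t_pp′` lever (doping discriminant `≤ 0`). At the oxygen-rich virtual corner of a wide box the
discriminant can change sign on the relevant energy window (La₂CuO₄ 3BE box at x = 0: `dopingDisc(V_lo; ε, ε)` crosses zero at ε ≈ 1.90 eV). This file
gives the closure that needs NO sign:

* §1 THE ENERGY-DIFFERENCE FORMULA (`fsRatio_sub_fsRatio_eq`): `fsRatio(ε₂) − fsRatio(ε₁) = −(ε₂ − ε₁)·dopingDisc(ε₁, ε₂)/(T(ε₁)T(ε₂))`, `T = fsD + 2fsN`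
  (exact, from `cross_eq_sub_mul_dopingDisc`); the discriminant is coordinatewise NON-DECREASING in the two energies on `[0, ∞)²` for `0 ≤ t_pp′ ≤ t_pp`
  (`dopingDisc_mono_left/right`, `abs_dopingDisc_le_of_diag`): on a window `[p, q]²` it lies between its diagonal values `dd(p, p) ≤ dd ≤ dd(q, q)`.
* §2 WINDOW BOUNDS AT A FIXED ROW (`fsT_mono_on_window`, `fsRatio_ge_on_window`, `fsRatio_le_on_window`): on `[p, q]` with `0 ≤ p`, `t_pp′(Δ + 2q) ≤ t_pd²`
  (so `T` is non-decreasing) and `|dopingDisc| ≤ M` on the diagonal ends: **`fsRatio(p) − (q − p)M/T(p)² ≤ fsRatio(ε) ≤ fsRatio(q) + (q − p)M/T(p)²`** — a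
  Lipschitz-in-energy enclosure whose width is second order in practice (`M` small where the discriminant changes sign); and the monotone special case
  (`fsRatio_mem_Icc_on_window_of_dopingDisc_nonpos`): `dd(q, q) ≤ 0 ⇒ fsRatio(p) ≤ fsRatio(ε) ≤ fsRatio(q)` on the window.
* §3 THE FIXED-ENERGY COLLAPSE (`fsRatio_fermiEnergyOf_ray_ge_virtual_at`, `…_le_virtual_at`): the lower ray row `(Δ₁, a₁, b₂, c·b₂/b)` has `t_pp′ ≤ c₂b₂/b₁`,
  so AT ITS OWN Fermi energy `E_row` its shape is `≥ fsRatio(V_lo; E_row)` (`fsRatio_anti_tppP_at`, §B.85 (m)), and `E_row ∈ [ε_F(V_lo), ε_F(Δ₁, a₁, b₂, c₁)]`;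
  symmetrically the upper ray row is `≤ fsRatio(V_hi; E_row′)` with `E_row′ ∈ [ε_F(Δ₂, a₂, b₁, c₂), ε_F(V_hi)]`.
* §4 **THE WINDOW CLOSURE** (`fsRatio_fermiEnergyOf_mem_Icc_windowClosure`): for every member, **`L ≤ R(θ) ≤ U`** whenever `L ≤ fsRatio(V_lo; ε)` on a window
  `[e₁, e₂] ⊇ [ε_F(V_lo), ε_F(Δ₁, a₁, b₂, c₁)]` and `fsRatio(V_hi; ε) ≤ U` on a window `[e₃, e₄] ⊇ [ε_F(Δ₂, a₂, b₁, c₂), ε_F(V_hi)]` (brackets from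
  `pointBracketCheck`s; `e₃ = 0` is admissible) — the hypotheses are discharged by §2 at the two fixed rows. When the discriminant is `≤ 0` on both windows
  this IS the two-virtual-corner rule (`L = R(V_lo)`, `U = R(V_hi)` up to the brackets); otherwise the price is the Lipschitz term.
  Instance: `EmeryBoxesLa214ShapeCorners`.

Sources: three-band model [HybertsenSchluterChristensen1989, Eq. (1)]; contour form [AndersenEtAl1995, §6]; arithmetic [folklore].
-/

noncomputable section

namespace Summit.Ventures.CertifiedManyBodySolver.Downfold.Emery

open Real Set

/-! ## §1 The energy-difference formula and the monotone discriminant -/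

section Formula

variable {Δ a b c : ℝ}

/-- **`fsRatio(ε₂) − fsRatio(ε₁) = −(ε₂ − ε₁)·dopingDisc(ε₁, ε₂)/(T₁T₂)`** with `T = fsD + 2fsN ≠ 0` at both energies. [folklore] -/
theorem fsRatio_sub_fsRatio_eq {ε₁ ε₂ : ℝ} (hT₁ : fsD Δ a c ε₁ + 2 * fsN a b c ε₁ ≠ 0) (hT₂ : fsD Δ a c ε₂ + 2 * fsN a b c ε₂ ≠ 0) :
    fsRatio Δ a b c ε₂ - fsRatio Δ a b c ε₁ =
      -((ε₂ - ε₁) * dopingDisc Δ a b c ε₁ ε₂) / ((fsD Δ a c ε₁ + 2 * fsN a b c ε₁) * (fsD Δ a c ε₂ + 2 * fsN a b c ε₂)) := by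
  unfold fsRatio
  rw [← cross_eq_sub_mul_dopingDisc, div_sub_div _ _ hT₂ hT₁, div_eq_div_iff (mul_ne_zero hT₂ hT₁) (mul_ne_zero hT₁ hT₂)]
  unfold fsD fsN
  ring

/-- The discriminant is non-decreasing in its first energy on `[0, ∞)` (second energy `≥ 0`; `0 ≤ t_pp′ ≤ t_pp`). [folklore] -/
theorem dopingDisc_mono_left {e e' f : ℝ} (hc : 0 ≤ c) (hcb : c ≤ b) (hf : 0 ≤ f) (hee : e ≤ e') :
    dopingDisc Δ a b c e f ≤ dopingDisc Δ a b c e' f := by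
  unfold dopingDisc
  have hb : 0 ≤ b := hc.trans hcb
  have h1 : 0 ≤ a ^ 2 * (2 * c * (c + b)) := by positivity
  have h2 : 0 ≤ c * (b ^ 2 - c ^ 2) * f := mul_nonneg (mul_nonneg hc (by nlinarith)) hf
  nlinarith [mul_le_mul_of_nonneg_left hee h1, mul_le_mul_of_nonneg_left hee h2]

/-- The discriminant is non-decreasing in its second energy on `[0, ∞)`. [folklore] -/
theorem dopingDisc_mono_right {e f f' : ℝ} (hc : 0 ≤ c) (hcb : c ≤ b) (he : 0 ≤ e) (hff : f ≤ f') :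
    dopingDisc Δ a b c e f ≤ dopingDisc Δ a b c e f' := by
  rw [dopingDisc_comm Δ a b c e f, dopingDisc_comm Δ a b c e f']
  exact dopingDisc_mono_left hc hcb he hff

/-- On a window `[p, q]²` (`0 ≤ p`) the discriminant lies between its diagonal end values: `dd(p, p) ≤ dd(ε, ε′) ≤ dd(q, q)`. [folklore] -/
theorem dopingDisc_mem_Icc_diag {p q ε ε' : ℝ} (hc : 0 ≤ c) (hcb : c ≤ b) (hp : 0 ≤ p) (hε : ε ∈ Icc p q) (hε' : ε' ∈ Icc p q) :
    dopingDisc Δ a b c ε ε' ∈ Icc (dopingDisc Δ a b c p p) (dopingDisc Δ a b c q q) := by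
  have hε0 : 0 ≤ ε := hp.trans hε.1
  have hε'0 : 0 ≤ ε' := hp.trans hε'.1
  constructor
  · calc dopingDisc Δ a b c p p ≤ dopingDisc Δ a b c ε p := dopingDisc_mono_left hc hcb hp hε.1
      _ ≤ dopingDisc Δ a b c ε ε' := dopingDisc_mono_right hc hcb hε0 hε'.1
  · calc dopingDisc Δ a b c ε ε' ≤ dopingDisc Δ a b c q ε' := dopingDisc_mono_left hc hcb hε'0 hε.2
      _ ≤ dopingDisc Δ a b c q q := dopingDisc_mono_right hc hcb (hε0.trans hε.2) hε'.2

/-- Hence `|dd(ε, ε′)| ≤ M` on the window as soon as `−M ≤ dd(p, p)` and `dd(q, q) ≤ M`. [folklore] -/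
theorem abs_dopingDisc_le_of_diag {p q ε ε' M : ℝ} (hc : 0 ≤ c) (hcb : c ≤ b) (hp : 0 ≤ p) (hε : ε ∈ Icc p q) (hε' : ε' ∈ Icc p q)
    (hMp : -M ≤ dopingDisc Δ a b c p p) (hMq : dopingDisc Δ a b c q q ≤ M) : |dopingDisc Δ a b c ε ε'| ≤ M := by
  have h := dopingDisc_mem_Icc_diag (Δ := Δ) (a := a) hc hcb hp hε hε'
  rw [abs_le]; exact ⟨hMp.trans h.1, h.2.trans hMq⟩

end Formula

/-! ## §2 Window bounds at a fixed row -/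

section Window

variable {Δ a b c p q : ℝ}

/-- `T = fsD + 2fsN` is non-decreasing on `[p, q]` when `t_pp′(Δ + 2q) ≤ t_pd²`… precisely: for `p ≤ ε ≤ ε′ ≤ q`, `T(ε) ≤ T(ε′)` (`0 ≤ t_pp′ ≤ t_pp`,
`t_pp′·(Δ + 2q) ≤ t_pd²`). [folklore] -/
theorem fsT_mono_on_window {ε ε' : ℝ} (hc : 0 ≤ c) (hcb : c ≤ b) (hcapw : c * (Δ + 2 * q) ≤ a ^ 2) (hεε : ε ≤ ε') (hε'q : ε' ≤ q) :
    fsD Δ a c ε + 2 * fsN a b c ε ≤ fsD Δ a c ε' + 2 * fsN a b c ε' := by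
  have hD : fsD Δ a c ε ≤ fsD Δ a c ε' := by
    unfold fsD
    have hkey : (Δ + ε') * (a ^ 2 - c * ε') - (Δ + ε) * (a ^ 2 - c * ε) = (ε' - ε) * (a ^ 2 - c * Δ - c * (ε + ε')) := by ring
    have h1 : 0 ≤ a ^ 2 - c * Δ - c * (ε + ε') := by nlinarith [mul_le_mul_of_nonneg_left (show ε + ε' ≤ 2 * q by linarith) hc]
    nlinarith [mul_nonneg (show 0 ≤ ε' - ε by linarith) h1]
  have hN : fsN a b c ε ≤ fsN a b c ε' := by
    unfold fsN
    have : 0 ≤ b ^ 2 - c ^ 2 := by nlinarith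
    nlinarith [mul_le_mul_of_nonneg_right hεε this]
  linarith

/-- **LOWER WINDOW BOUND**: on `[p, q]` (`0 ≤ p`, `0 ≤ Δ + p`, `t_pp′(Δ + 2q) ≤ t_pd²`, `T(p) > 0`, `|dd| ≤ M` at the diagonal ends):
`fsRatio(p) − (q − p)·M/T(p)² ≤ fsRatio(ε)` for every `ε ∈ [p, q]`. [folklore] -/
theorem fsRatio_ge_on_window {ε M : ℝ} (hc : 0 ≤ c) (hcb : c ≤ b) (hp : 0 ≤ p) (hcapw : c * (Δ + 2 * q) ≤ a ^ 2)
    (hT0 : 0 < fsD Δ a c p + 2 * fsN a b c p) (hMp : -M ≤ dopingDisc Δ a b c p p) (hMq : dopingDisc Δ a b c q q ≤ M) (hε : ε ∈ Icc p q) :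
    fsRatio Δ a b c p - (q - p) * M / (fsD Δ a c p + 2 * fsN a b c p) ^ 2 ≤ fsRatio Δ a b c ε := by
  set T₀ := fsD Δ a c p + 2 * fsN a b c p with hT₀
  set Tε := fsD Δ a c ε + 2 * fsN a b c ε with hTε
  have hTT : T₀ ≤ Tε := fsT_mono_on_window hc hcb hcapw hε.1 hε.2
  have hTε0 : 0 < Tε := lt_of_lt_of_le hT0 hTT
  have hM0 : 0 ≤ M := by
    have := abs_dopingDisc_le_of_diag (Δ := Δ) (a := a) hc hcb hp ⟨le_rfl, hε.1.trans hε.2⟩ ⟨le_rfl, hε.1.trans hε.2⟩ hMp hMq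
    exact (abs_nonneg _).trans this
  have hdiff := fsRatio_sub_fsRatio_eq (Δ := Δ) (a := a) (b := b) (c := c) (ε₁ := p) (ε₂ := ε) hT0.ne' hTε0.ne'
  have habs : |dopingDisc Δ a b c p ε| ≤ M := abs_dopingDisc_le_of_diag hc hcb hp ⟨le_rfl, hε.1.trans hε.2⟩ hε hMp hMq
  -- |fsRatio ε − fsRatio p| ≤ (ε − p) M /(T₀ Tε) ≤ (q − p) M / T₀²
  have hbound : |fsRatio Δ a b c ε - fsRatio Δ a b c p| ≤ (q - p) * M / T₀ ^ 2 := by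
    rw [hdiff, abs_div, abs_neg, abs_mul, abs_of_nonneg (show 0 ≤ ε - p by linarith [hε.1]),
      abs_of_pos (mul_pos hT0 hTε0)]
    have h1 : (ε - p) * |dopingDisc Δ a b c p ε| ≤ (q - p) * M :=
      mul_le_mul (by linarith [hε.2]) habs (abs_nonneg _) (by linarith [hε.1, hε.2])
    have h2 : T₀ ^ 2 ≤ T₀ * Tε := by rw [pow_two]; exact mul_le_mul_of_nonneg_left hTT hT0.le
    have h3 : 0 < T₀ ^ 2 := pow_pos hT0 2
    calc (ε - p) * |dopingDisc Δ a b c p ε| / (T₀ * Tε) ≤ (q - p) * M / (T₀ * Tε) :=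
          div_le_div_of_nonneg_right h1 (mul_pos hT0 hTε0).le
      _ ≤ (q - p) * M / T₀ ^ 2 := div_le_div_of_nonneg_left (by nlinarith [hε.1, hε.2]) h3 h2
  have := (abs_le.mp hbound).1
  linarith

/-- **UPPER WINDOW BOUND**: `fsRatio(ε) ≤ fsRatio(q) + (q − p)·M/T(p)²` for every `ε ∈ [p, q]` (same hypotheses). [folklore] -/
theorem fsRatio_le_on_window {ε M : ℝ} (hc : 0 ≤ c) (hcb : c ≤ b) (hp : 0 ≤ p) (hcapw : c * (Δ + 2 * q) ≤ a ^ 2)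
    (hT0 : 0 < fsD Δ a c p + 2 * fsN a b c p) (hMp : -M ≤ dopingDisc Δ a b c p p) (hMq : dopingDisc Δ a b c q q ≤ M) (hε : ε ∈ Icc p q) :
    fsRatio Δ a b c ε ≤ fsRatio Δ a b c q + (q - p) * M / (fsD Δ a c p + 2 * fsN a b c p) ^ 2 := by
  set T₀ := fsD Δ a c p + 2 * fsN a b c p with hT₀
  set Tε := fsD Δ a c ε + 2 * fsN a b c ε with hTε
  set Tq := fsD Δ a c q + 2 * fsN a b c q with hTq
  have hpq : p ≤ q := hε.1.trans hε.2
  have hTT : T₀ ≤ Tε := fsT_mono_on_window hc hcb hcapw hε.1 hε.2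
  have hTq' : T₀ ≤ Tq := fsT_mono_on_window hc hcb hcapw hpq le_rfl
  have hTε0 : 0 < Tε := lt_of_lt_of_le hT0 hTT
  have hTq0 : 0 < Tq := lt_of_lt_of_le hT0 hTq'
  have hdiff := fsRatio_sub_fsRatio_eq (Δ := Δ) (a := a) (b := b) (c := c) (ε₁ := ε) (ε₂ := q) hTε0.ne' hTq0.ne'
  have habs : |dopingDisc Δ a b c ε q| ≤ M := abs_dopingDisc_le_of_diag hc hcb hp hε ⟨hpq, le_rfl⟩ hMp hMq
  have hbound : |fsRatio Δ a b c q - fsRatio Δ a b c ε| ≤ (q - p) * M / T₀ ^ 2 := by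
    rw [hdiff, abs_div, abs_neg, abs_mul, abs_of_nonneg (show 0 ≤ q - ε by linarith [hε.2]),
      abs_of_pos (mul_pos hTε0 hTq0)]
    have h1 : (q - ε) * |dopingDisc Δ a b c ε q| ≤ (q - p) * M :=
      mul_le_mul (by linarith [hε.1]) habs (abs_nonneg _) (by linarith)
    have h2 : T₀ ^ 2 ≤ Tε * Tq := by rw [pow_two]; exact mul_le_mul hTT hTq' hT0.le hTε0.le
    have h3 : 0 < T₀ ^ 2 := pow_pos hT0 2
    have hM0 : 0 ≤ (q - p) * M := by
      have : 0 ≤ M := (abs_nonneg _).trans habs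
      exact mul_nonneg (by linarith) this
    calc (q - ε) * |dopingDisc Δ a b c ε q| / (Tε * Tq) ≤ (q - p) * M / (Tε * Tq) :=
          div_le_div_of_nonneg_right h1 (mul_pos hTε0 hTq0).le
      _ ≤ (q - p) * M / T₀ ^ 2 := div_le_div_of_nonneg_left hM0 h3 h2
  have := (abs_le.mp hbound).1
  linarith

/-- **MONOTONE SPECIAL CASE**: if `dd(q, q) ≤ 0` then the shape is non-decreasing on the window: `fsRatio(p) ≤ fsRatio(ε) ≤ fsRatio(q)` for `ε ∈ [p, q]`
(`0 ≤ p`, `0 ≤ Δ + p`, `t_pd ≠ 0`, `0 < t_pp`, `0 ≤ t_pp′ ≤ t_pp`, regime `t_pp′q ≤ t_pd²`). [folklore] -/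
theorem fsRatio_mem_Icc_on_window_of_dopingDisc_nonpos {ε : ℝ} (ha : a ≠ 0) (hb : 0 < b) (hc : 0 ≤ c) (hcb : c ≤ b) (hp : 0 ≤ p) (hΔp : 0 ≤ Δ + p)
    (hreg : c * q ≤ a ^ 2) (hdd : dopingDisc Δ a b c q q ≤ 0) (hε : ε ∈ Icc p q) :
    fsRatio Δ a b c ε ∈ Icc (fsRatio Δ a b c p) (fsRatio Δ a b c q) := by
  have hpq : p ≤ q := hε.1.trans hε.2
  have hε0 : 0 ≤ ε := hp.trans hε.1
  constructor
  · refine fsRatio_mono_energy_of_dopingDisc ha hb hc hcb hp hε.1 hΔp (le_trans (mul_le_mul_of_nonneg_left hε.2 hc) hreg) ?_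
    exact (dopingDisc_mem_Icc_diag (Δ := Δ) (a := a) hc hcb hp ⟨le_rfl, hpq⟩ hε).2.trans hdd
  · refine fsRatio_mono_energy_of_dopingDisc ha hb hc hcb hε0 hε.2 (by linarith [hε.1]) hreg ?_
    exact (dopingDisc_mem_Icc_diag (Δ := Δ) (a := a) hc hcb hp hε ⟨hpq, le_rfl⟩).2.trans hdd

end Window

/-! ## §3 The fixed-energy collapse of the two ray rows onto the virtual corners -/

section Collapse

variable {Δ a b c Δ₁ Δ₂ a₁ a₂ b₁ b₂ c₁ c₂ ν : ℝ}

/-- **LOWER COLLAPSE**: for a member `θ` of the box (two-ray regime), with `W = [e₁, e₂] ⊇ [ε_F(V_lo), ε_F(Δ₁, a₁, b₂, c₁)]`, `(c₂b₂/b₁)·e₂ ≤ a₁²`: there is an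
energy `E ∈ W` (the lower ray row's own Fermi energy) with `fsRatio(V_lo; E) ≤ R(θ)`. [folklore] -/
theorem fsRatio_fermiEnergyOf_ge_virtual_at {e₁ e₂ : ℝ} (hΔ₁ : 0 < Δ₁) (ha₁ : 0 < a₁) (hb₁ : 0 < b₁) (hc₁ : 0 ≤ c₁) (hc₂b : c₂ ≤ b₁)
    (hΔ : Δ ∈ Icc Δ₁ Δ₂) (ha : a ∈ Icc a₁ a₂) (hb : b ∈ Icc b₁ b₂) (hc : c ∈ Icc c₁ c₂) (hν0 : 0 < ν) (hν1 : ν < 1)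
    (hreg : c₂ * b₂ * fermiEnergyOf Δ₁ a₂ b₂ c₁ ν ≤ a₁ ^ 2 * b₁)
    (he₁ : e₁ ≤ fermiEnergyOf Δ₁ a₁ b₂ (c₂ * b₂ / b₁) ν) (he₂ : fermiEnergyOf Δ₁ a₁ b₂ c₁ ν ≤ e₂) (hcap₂ : c₂ * b₂ / b₁ * e₂ ≤ a₁ ^ 2) :
    ∃ E ∈ Icc e₁ e₂, fsRatio Δ₁ a₁ b₂ (c₂ * b₂ / b₁) E ≤ fsRatio Δ a b c (fermiEnergyOf Δ a b c ν) := by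
  obtain ⟨hlo, -⟩ := fsRatio_fermiEnergyOf_twoRay hΔ₁ ha₁ hb₁ hc₁ hc₂b hΔ ha hb hc hν0 hν1 hreg
  obtain ⟨hΔl, hΔu⟩ := hΔ
  obtain ⟨hal, hau⟩ := ha
  obtain ⟨hbl, hbu⟩ := hb
  obtain ⟨hcl, hcu⟩ := hc
  have hb0 : 0 < b := lt_of_lt_of_le hb₁ hbl
  have hb₂ : 0 < b₂ := lt_of_lt_of_le hb0 hbu
  have hc0 : 0 ≤ c := hc₁.trans hcl
  have hc₂ : 0 ≤ c₂ := hc0.trans hcu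
  have hcray : c ≤ c * b₂ / b := by
    rw [le_div_iff₀ hb0]; exact mul_le_mul_of_nonneg_left hbu hc0
  have hcray' : c * b₂ / b ≤ c₂ * b₂ / b₁ := by
    rw [div_le_div_iff₀ hb0 hb₁]
    have h : c * b₁ ≤ c₂ * b := mul_le_mul hcu hbl hb₁.le hc₂
    calc c * b₂ * b₁ = c * b₁ * b₂ := by ring
      _ ≤ c₂ * b * b₂ := mul_le_mul_of_nonneg_right h hb₂.le
      _ = c₂ * b₂ * b := by ring
  have hvlo_b : c₂ * b₂ / b₁ ≤ b₂ := by
    rw [div_le_iff₀ hb₁, mul_comm]; exact mul_le_mul_of_nonneg_left hc₂b hb₂.le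
  set E := fermiEnergyOf Δ₁ a₁ b₂ (c * b₂ / b) ν with hE
  have hE0 : 0 < E := fermiEnergyOf_pos hΔ₁ ha₁.ne' (hc0.trans hcray) hb₂.le hν0 hν1
  have hElo : e₁ ≤ E := he₁.trans (fermiEnergyOf_anti_tppP' hΔ₁ ha₁.ne' (hc0.trans hcray) hcray' hb₂.le hν0 hν1)
  have hEhi : E ≤ e₂ := (fermiEnergyOf_anti_tppP' hΔ₁ ha₁.ne' hc₁ (hcl.trans hcray) hb₂.le hν0 hν1).trans he₂
  refine ⟨E, ⟨hElo, hEhi⟩, le_trans ?_ hlo⟩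
  -- fixed-energy t_pp′ comparison at E: c b₂/b ≤ c₂ b₂/b₁
  exact fsRatio_anti_tppP_at ha₁.ne' hb₂ (hc0.trans hcray) hcray' hvlo_b hE0.le (by linarith)
    (le_trans (mul_le_mul_of_nonneg_left hEhi (by positivity)) hcap₂)

/-- **UPPER COLLAPSE**: with `W′ = [e₃, e₄] ⊇ [ε_F(Δ₂, a₂, b₁, c₂), ε_F(V_hi)]`, `c₂e₄ ≤ a₂²`: there is `E′ ∈ W′` (the upper ray row's own Fermi energy) with
`R(θ) ≤ fsRatio(V_hi; E′)`. [folklore] -/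
theorem fsRatio_fermiEnergyOf_le_virtual_at {e₃ e₄ : ℝ} (hΔ₁ : 0 < Δ₁) (ha₁ : 0 < a₁) (hb₁ : 0 < b₁) (hc₁ : 0 ≤ c₁) (hc₂b : c₂ ≤ b₁)
    (hΔ : Δ ∈ Icc Δ₁ Δ₂) (ha : a ∈ Icc a₁ a₂) (hb : b ∈ Icc b₁ b₂) (hc : c ∈ Icc c₁ c₂) (hν0 : 0 < ν) (hν1 : ν < 1)
    (hreg : c₂ * b₂ * fermiEnergyOf Δ₁ a₂ b₂ c₁ ν ≤ a₁ ^ 2 * b₁)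
    (he₃ : e₃ ≤ fermiEnergyOf Δ₂ a₂ b₁ c₂ ν) (he₄ : fermiEnergyOf Δ₂ a₂ b₁ (c₁ * b₁ / b₂) ν ≤ e₄) (hcap₄ : c₂ * e₄ ≤ a₂ ^ 2) :
    ∃ E ∈ Icc e₃ e₄, fsRatio Δ a b c (fermiEnergyOf Δ a b c ν) ≤ fsRatio Δ₂ a₂ b₁ (c₁ * b₁ / b₂) E := by
  obtain ⟨-, hup⟩ := fsRatio_fermiEnergyOf_twoRay hΔ₁ ha₁ hb₁ hc₁ hc₂b hΔ ha hb hc hν0 hν1 hreg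
  obtain ⟨hΔl, hΔu⟩ := hΔ
  obtain ⟨hal, hau⟩ := ha
  obtain ⟨hbl, hbu⟩ := hb
  obtain ⟨hcl, hcu⟩ := hc
  have hΔ₂ : 0 < Δ₂ := lt_of_lt_of_le hΔ₁ (hΔl.trans hΔu)
  have ha₂ : 0 < a₂ := lt_of_lt_of_le ha₁ (hal.trans hau)
  have hb0 : 0 < b := lt_of_lt_of_le hb₁ hbl
  have hb₂ : 0 < b₂ := lt_of_lt_of_le hb0 hbu
  have hc0 : 0 ≤ c := hc₁.trans hcl
  have hcup : c₁ * b₁ / b₂ ≤ c * b₁ / b := by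
    rw [div_le_div_iff₀ hb₂ hb0]
    have h : c₁ * b ≤ c * b₂ := mul_le_mul hcl hbu hb0.le hc0
    calc c₁ * b₁ * b = c₁ * b * b₁ := by ring
      _ ≤ c * b₂ * b₁ := mul_le_mul_of_nonneg_right h hb₁.le
      _ = c * b₁ * b₂ := by ring
  have hcup' : c * b₁ / b ≤ c := by
    rw [div_le_iff₀ hb0]; exact mul_le_mul_of_nonneg_left hbl hc0
  have hcup0 : 0 ≤ c₁ * b₁ / b₂ := by positivity
  set E := fermiEnergyOf Δ₂ a₂ b₁ (c * b₁ / b) ν with hE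
  have hE0 : 0 < E := fermiEnergyOf_pos hΔ₂ ha₂.ne' (hcup0.trans hcup) hb₁.le hν0 hν1
  have hElo : e₃ ≤ E := he₃.trans (fermiEnergyOf_anti_tppP' hΔ₂ ha₂.ne' (hcup0.trans hcup) (hcup'.trans hcu) hb₁.le hν0 hν1)
  have hEhi : E ≤ e₄ := (fermiEnergyOf_anti_tppP' hΔ₂ ha₂.ne' hcup0 hcup hb₁.le hν0 hν1).trans he₄
  refine ⟨E, ⟨hElo, hEhi⟩, le_trans hup ?_⟩
  -- fixed-energy t_pp′ comparison at E: c₁ b₁/b₂ ≤ c b₁/b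
  exact fsRatio_anti_tppP_at ha₂.ne' hb₁ hcup0 hcup (hcup'.trans (hcu.trans hc₂b)) hE0.le (by linarith)
    (le_trans (mul_le_mul (hcup'.trans hcu) hEhi hE0.le (hc0.trans hcu)) hcap₄)

end Collapse

/-! ## §4 The window closure -/

/-- **THE WINDOW CLOSURE OF THE TWO-RAY RULE**: for every member of `[Δ₁, Δ₂] × [a₁, a₂] × [b₁, b₂] × [c₁, c₂]` (`c₂ ≤ b₁`; two-ray regime),
**`L ≤ R(θ) ≤ U`** as soon as `L ≤ fsRatio(V_lo; ε)` on `[e₁, e₂] ⊇ [ε_F(V_lo), ε_F(Δ₁, a₁, b₂, c₁)]` and `fsRatio(V_hi; ε) ≤ U` on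
`[e₃, e₄] ⊇ [ε_F(Δ₂, a₂, b₁, c₂), ε_F(V_hi)]` (with `(c₂b₂/b₁)e₂ ≤ a₁²`, `c₂e₄ ≤ a₂²`). [folklore] -/
theorem fsRatio_fermiEnergyOf_mem_Icc_windowClosure {Δ a b c Δ₁ Δ₂ a₁ a₂ b₁ b₂ c₁ c₂ e₁ e₂ e₃ e₄ L U ν : ℝ} (hΔ₁ : 0 < Δ₁) (ha₁ : 0 < a₁)
    (hb₁ : 0 < b₁) (hc₁ : 0 ≤ c₁) (hc₂b : c₂ ≤ b₁)
    (hΔ : Δ ∈ Icc Δ₁ Δ₂) (ha : a ∈ Icc a₁ a₂) (hb : b ∈ Icc b₁ b₂) (hc : c ∈ Icc c₁ c₂) (hν0 : 0 < ν) (hν1 : ν < 1)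
    (hreg : c₂ * b₂ * fermiEnergyOf Δ₁ a₂ b₂ c₁ ν ≤ a₁ ^ 2 * b₁)
    (he₁ : e₁ ≤ fermiEnergyOf Δ₁ a₁ b₂ (c₂ * b₂ / b₁) ν) (he₂ : fermiEnergyOf Δ₁ a₁ b₂ c₁ ν ≤ e₂) (hcap₂ : c₂ * b₂ / b₁ * e₂ ≤ a₁ ^ 2)
    (hL : ∀ ε ∈ Icc e₁ e₂, L ≤ fsRatio Δ₁ a₁ b₂ (c₂ * b₂ / b₁) ε)
    (he₃ : e₃ ≤ fermiEnergyOf Δ₂ a₂ b₁ c₂ ν) (he₄ : fermiEnergyOf Δ₂ a₂ b₁ (c₁ * b₁ / b₂) ν ≤ e₄) (hcap₄ : c₂ * e₄ ≤ a₂ ^ 2)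
    (hU : ∀ ε ∈ Icc e₃ e₄, fsRatio Δ₂ a₂ b₁ (c₁ * b₁ / b₂) ε ≤ U) :
    fsRatio Δ a b c (fermiEnergyOf Δ a b c ν) ∈ Icc L U := by
  obtain ⟨E, hEW, hEle⟩ := fsRatio_fermiEnergyOf_ge_virtual_at hΔ₁ ha₁ hb₁ hc₁ hc₂b hΔ ha hb hc hν0 hν1 hreg he₁ he₂ hcap₂
  obtain ⟨E', hE'W, hE'le⟩ := fsRatio_fermiEnergyOf_le_virtual_at hΔ₁ ha₁ hb₁ hc₁ hc₂b hΔ ha hb hc hν0 hν1 hreg he₃ he₄ hcap₄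
  exact ⟨(hL E hEW).trans hEle, hE'le.trans (hU E' hE'W)⟩

/-! ## §5 (appended, g35) The antitone window: the other sign of the discriminant -/

section Antitone

variable {Δ a b c p q : ℝ}

/-- At a common row, two energies `0 ≤ E′ ≤ E` in the regime `cE ≤ t_pd²` with `dopingDisc(E′, E) ≥ 0`: `fsRatio(E) ≤ fsRatio(E′)` (the `≤`-regime form of
`fsRatio_anti_of_dopingDisc_nonneg`: on the large-Δ / large-t_pp′ side of the discriminant the shape DECREASES with the energy). [folklore] -/
theorem fsRatio_anti_energy_of_dopingDisc {E E' : ℝ} (ha : a ≠ 0) (hb : 0 < b) (hc : 0 ≤ c) (hcb : c ≤ b) (hE' : 0 ≤ E') (hEE : E' ≤ E)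
    (hΔE : 0 ≤ Δ + E') (hreg : c * E ≤ a ^ 2) (hdisc : 0 ≤ dopingDisc Δ a b c E' E) :
    fsRatio Δ a b c E ≤ fsRatio Δ a b c E' := by
  have ha2 : 0 < a ^ 2 := by positivity
  have hbc : 0 ≤ b ^ 2 - c ^ 2 := by nlinarith
  have hN1 : 0 < fsN a b c E := by
    unfold fsN
    have : 0 < 2 * a ^ 2 * (c + b) := by positivity
    nlinarith
  have hN2 : 0 < fsN a b c E' := by
    unfold fsN
    have : 0 < 2 * a ^ 2 * (c + b) := by positivity
    nlinarith
  have hD1 : 0 ≤ fsD Δ a c E := by unfold fsD; exact mul_nonneg (by linarith) (by linarith)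
  have hD2 : 0 ≤ fsD Δ a c E' := by unfold fsD; exact mul_nonneg hΔE (by nlinarith)
  unfold fsRatio
  refine negRatio_le_of_cross hN1 hN2 hD1 hD2 ?_
  have h := cross_eq_sub_mul_dopingDisc Δ a b c E' E
  have : 0 ≤ (E - E') * dopingDisc Δ a b c E' E := mul_nonneg (by linarith) hdisc
  linarith

/-- **ANTITONE SPECIAL CASE**: if `dd(p, p) ≥ 0` then the shape is non-increasing on the window `[p, q]`: `fsRatio(q) ≤ fsRatio(ε) ≤ fsRatio(p)` for `ε ∈ [p, q]`
(`0 ≤ p`, `0 ≤ Δ + p`, `t_pd ≠ 0`, `0 < t_pp`, `0 ≤ t_pp′ ≤ t_pp`, regime `t_pp′q ≤ t_pd²`) — the large-`t_pp′` virtual corners of wide boxes (Hg1201) live here. [folklore] -/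
theorem fsRatio_mem_Icc_on_window_of_dopingDisc_nonneg {ε : ℝ} (ha : a ≠ 0) (hb : 0 < b) (hc : 0 ≤ c) (hcb : c ≤ b) (hp : 0 ≤ p) (hΔp : 0 ≤ Δ + p)
    (hreg : c * q ≤ a ^ 2) (hdd : 0 ≤ dopingDisc Δ a b c p p) (hε : ε ∈ Icc p q) :
    fsRatio Δ a b c ε ∈ Icc (fsRatio Δ a b c q) (fsRatio Δ a b c p) := by
  have hpq : p ≤ q := hε.1.trans hε.2
  have hε0 : 0 ≤ ε := hp.trans hε.1
  constructor
  · refine fsRatio_anti_energy_of_dopingDisc ha hb hc hcb hε0 hε.2 (by linarith [hε.1]) hreg ?_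
    exact hdd.trans (dopingDisc_mem_Icc_diag (Δ := Δ) (a := a) hc hcb hp hε ⟨hpq, le_rfl⟩).1
  · refine fsRatio_anti_energy_of_dopingDisc ha hb hc hcb hp hε.1 hΔp (le_trans (mul_le_mul_of_nonneg_left hε.2 hc) hreg) ?_
    exact hdd.trans (dopingDisc_mem_Icc_diag (Δ := Δ) (a := a) hc hcb hp ⟨le_rfl, hpq⟩ hε).1

end Antitone

end Summit.Ventures.CertifiedManyBodySolver.Downfold.Emery
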